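import Summits.CriticalPhenomena.Ising3DConformalLimit.Theses.FKParityRobustness
import Summits.CriticalPhenomena.Ising3DConformalLimit.Theorems.FKParityRobustnessParityBoundCurrents
import Summits.CriticalPhenomena.Ising3DConformalLimit.Theorems.FKParityRobustnessFarMergingGivesU4
import Literature.Probability.LatticeModels.WeightedCurrents
import Literature.Probability.LatticeModels.IsingTransport
import Literature.Probability.LatticeModels.CriticalCorrWellDefined
import HarnessLib

/-!
# Line `odd-part-fubini` for crux `JoinForcesU4` (stmt-CriticalPhenomena-14627) — CHECKED SKELETON

Crux (route `FKParityRobustness`, rank 6, the BRIDGE of the rev-4 spine), verbatim: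
`JoinForcesU4 : IndependentStrandsJoin → ∀ ρ S, (∀ δ ∈ Ioc 0 1, 0 < ρ δ) →
  HasPointwiseScalingLimit (criticalCorr 3) ρ S → IsNondegenerateTwoPoint S → HasNontrivialU4 S`.

LINE (card `Ideas/odd-part-fubini.md`; triage r1: pass ×2): DRESS BOTH STRANDS — the landed one-copy
odd-part law `tsum_sources_eweight_mul_apply_oddPart` (arbitrary functional) iterated ONCE by Tonelli is
the two-current law (S1); Aizenman's additive `U₄` identity `Current.ursellFour_currentSum_identity` with
`odd(nᵢ) ⊆ trace(n₁+n₂)` and NO switching lemma dominates `P` from below by the odd-join sum (S2); the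
law at `g = 1[a₀ ↔ a₂ in F₁ ∪ F₂]` evaluates that sum to `cosh^{2|E|}·J_{tanh β}` and the correlator
dictionary turns the `ℝ≥0∞` inequality into the route's support `StrandsJoinBound` (S3); K1 in the box,
free-measure transport and the free box limits at `β_c(ℤ³)` give the route's glue `LatticeBoundFromStrands`
(S4); the LANDED item 4471 `farMergingGivesU4_proof` closes the crux (`JoinForcesU4_of`, no stub inside).

Registered stubs (the ONLY declarations containing `sorry`): `stub_pairOddPartLaw` (S1),
`stub_aizenmanOddDomination` (S2), `stub_strandsJoinBound_of` (S3), `stub_latticeBoundFromStrands` (S4).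
Hardest: S4 (longest: transport + seven limits); load-bearing lever: S1.  EVERY STUB HAS A KERNEL-CHECKED
FILLING: the companion certificate `LineFilledOddPartFubini.lean` (this crux directory; = the seat's
`fill-odd-part-fubini.lean`, also attached as evidence on item 14627) is this file with the four bodies proved
(farm rc 0, 0 sorry; fillings adapted from `CandidateProof_JoinForcesU4.lean` / `SketchIdeator3.lean` of this crux
directory) — the lead's build is a landing, stub by stub (`propose --supports stmt-CriticalPhenomena-14627`).

Disproof / Negative knowledge honoured (`Cruxes/JoinForcesU4/Disproof.lean` cdisprove c1, landed as
`Theorems/JoinForcesU4/Negative/LoadBearing.lean`; cited in §4 — add the import and the two read-back `example`s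
kept in the seat's `line-lb.lean` once the farm serves that module): `not_crux_imp_not_support` — a
refutation must break the target of S3 (`StrandsJoinBound`) or of S4 (`LatticeBoundFromStrands`);
`withoutNondegeneracy_iff_not_strandsJoin` / `withoutLimit_iff_not_strandsJoin` — ND and the lattice-limit
clause are consumed inside item 4471 by `JoinForcesU4_of`, never bypassed; `iff_withoutPositivity` — `hρ` is
cosmetic and indeed only threaded through; §C.4 `not_loopAizenmanAllT` (Disproof.lean) — the all-`t`
polynomial strengthening of `StrandsJoinBound` is FALSE (C4, t = 2): this line never states it; `t = tanh β`
enters S3 only through the `cosh`-dressing of S1/S2 (currents with `β ≥ 0`), exactly where `t ≤ 1` lives;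
§D `not_farMergingAt_of_exists_limit` (d ≥ 5) — S1–S4 are dimension-free, the `d = 3` content is K1.
No `-- Targets` stub kill and no refuted strengthening is instantiated by any stub.

References: M. Aizenman, Comm. Math. Phys. 86 (1982), Prop. 5.1 [AizenmanCMP1982]; H. Duminil-Copin,
arXiv:1607.06933, Lemma 2.2, Remark 3.4, §4.3 eq. (24) [DuminilCopin2016]; U. T. Hansen, J. Jiang,
F. R. Klausen, arXiv:2506.10765, §2 [HansenJiangKlausen2025]; M. Aizenman, H. Duminil-Copin,
V. Sidoravicius, Comm. Math. Phys. 334 (2015), Thm 1.1 [AizenmanDuminilCopinSidoraviciusCMP2015];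
R. Panis, Ann. Probab. 54 (2026), arXiv:2309.05797, Prop. 4.7 [Panis2023Triviality].
-/

noncomputable section

namespace Summit.CriticalPhenomena.Ising3DConformalLimit.Cruxes.JoinForcesU4.OddPartFubini

open scoped BigOperators symmDiff ENNReal Topology
open Finset Filter Literature.Probability.LatticeModels
open Summit.CriticalPhenomena.Ising3DConformalLimit.Theses.FKParityRobustness
open Summit.CriticalPhenomena.Ising3DConformalLimit.Cruxes.ParityRobustMerging.PlaquetteXorSurgery
  (tetra tetra_inj)
open Summit.CriticalPhenomena.Ising3DConformalLimit.Theorems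
  (tsum_sources_eweight_mul_apply_oddPart coe_oddPart_subset_traced_add ecurrentSum_empty_eq_ofReal
    sinh_pow_mul_cosh_pow_sub)

/-! ## §1 The four stub STATEMENTS (named `Prop`s, for reading; the registered `stub_*` theorems of
§2 restate them verbatim over tree declarations, `*_holds` certify the agreement definitionally, and
`Registered.stub_*` are the name-keyed aliases used as the hypotheses of `JoinForcesU4_of`). -/

section Statements

open scoped Classical

/-- STUB 1 statement — **the two-current odd-part law** (THE LEVER of the card): under the product
weight `1{∂n₁ = A} 1{∂n₂ = B} w_β(n₁) w_β(n₂)` the pair `(odd n₁, odd n₂)` is distributed as two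
INDEPENDENT sourced loop-O(1) configurations, for an ARBITRARY functional `g ≥ 0`:
`Σ w w g(odd n₁, odd n₂) = Σ_{∂F₁=A} sh^{|F₁|}ch^{|E|−|F₁|} Σ_{∂F₂=B} sh^{|F₂|}ch^{|E|−|F₂|} g(F₁,F₂)`
(the landed one-copy law `tsum_sources_eweight_mul_apply_oddPart` iterated once by Tonelli). -/
def PairOddPartLaw : Prop :=
  ∀ (V : Type) [Fintype V] [DecidableEq V] (G : SimpleGraph V) [DecidableRel G.Adj] (β : ℝ), 0 ≤ β →
    ∀ (A B : Finset V) (g : Finset (Sym2 V) → Finset (Sym2 V) → ℝ≥0∞),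
      ∑' p : Current G × Current G,
          epairWeight (fun _ : G.edgeFinset => β) A B p *
            g ((Finset.univ.filter fun e : G.edgeFinset => Odd (p.1 e)).map (Function.Embedding.subtype _))
              ((Finset.univ.filter fun e : G.edgeFinset => Odd (p.2 e)).map (Function.Embedding.subtype _)) =
        ∑ F₁ ∈ G.edgeFinset.powerset, if (∀ v, Odd (F₁.filter (v ∈ ·)).card ↔ v ∈ A) then
          ENNReal.ofReal (Real.sinh β ^ F₁.card * Real.cosh β ^ (G.edgeFinset.card - F₁.card)) *
            ∑ F₂ ∈ G.edgeFinset.powerset, (if (∀ v, Odd (F₂.filter (v ∈ ·)).card ↔ v ∈ B) then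
              ENNReal.ofReal (Real.sinh β ^ F₂.card * Real.cosh β ^ (G.edgeFinset.card - F₂.card)) *
                g F₁ F₂ else 0)
          else 0

/-- STUB 2 statement — **Aizenman's identity with odd-part domination, no switching**: in the additive
`ℝ≥0∞` product form `Z[01]Z[23] + Z[02]Z[13] + Z[03]Z[12] = Z[D]Z[∅] + 2P`
(`Current.ursellFour_currentSum_identity`, `P = Σ w w 1[a₂ ∈ C_{n₁+n₂}(a₀)]`) replace `P` by the smaller
sum over `1[a₀ ↔ a₂ in odd(n₁) ∪ odd(n₂)]` (`odd(nᵢ) ⊆ trace(n₁+n₂)`, landed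
`coe_oddPart_subset_traced_add`): `Z[D]Z[∅] + 2·OddJoin ≤ ΣZZ`. No injectivity, no law needed. -/
def AizenmanOddDomination : Prop :=
  ∀ (V : Type) [Fintype V] [DecidableEq V] (G : SimpleGraph V) [DecidableRel G.Adj] (β : ℝ), 0 ≤ β →
    ∀ a : Fin 4 → V,
      ecurrentSum (fun _ : G.edgeFinset => β) ({a 0} ∆ ({a 1} ∆ ({a 2} ∆ {a 3}))) *
            ecurrentSum (fun _ : G.edgeFinset => β) ∅ +
          2 * (∑' p : Current G × Current G,
            epairWeight (fun _ : G.edgeFinset => β) ({a 0} ∆ {a 1}) ({a 2} ∆ {a 3}) p *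
              (if (SimpleGraph.fromEdgeSet
                  ((↑((Finset.univ.filter fun e : G.edgeFinset => Odd (p.1 e)).map
                      (Function.Embedding.subtype _)) : Set (Sym2 V)) ∪
                    ↑((Finset.univ.filter fun e : G.edgeFinset => Odd (p.2 e)).map
                      (Function.Embedding.subtype _)))).Reachable (a 0) (a 2)
                then 1 else 0)) ≤
        ecurrentSum (fun _ : G.edgeFinset => β) ({a 0} ∆ {a 1}) *
            ecurrentSum (fun _ : G.edgeFinset => β) ({a 2} ∆ {a 3}) +
          ecurrentSum (fun _ : G.edgeFinset => β) ({a 0} ∆ {a 2}) *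
            ecurrentSum (fun _ : G.edgeFinset => β) ({a 1} ∆ {a 3}) +
          ecurrentSum (fun _ : G.edgeFinset => β) ({a 0} ∆ {a 3}) *
            ecurrentSum (fun _ : G.edgeFinset => β) ({a 1} ∆ {a 2})

/-- STUB 3 statement — **from the law and the domination to the route's support `StrandsJoinBound`
(item 14647)**: evaluate `OddJoin = cosh(β)^{2|E|}·J_{tanh β}` by the law with `g = 1[a₀ ↔ a₂ in F₁ ∪ F₂]`
(`sh^k ch^{|E|-k} = ch^{|E|} th^k` termwise), cast the `ℝ≥0∞` inequality to `ℝ`, read the free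
correlators as current-sum ratios and divide by `Z[∅]² = cosh^{2|E|}(Z⁰_t)²`. -/
def StrandsJoinOfLaw : Prop :=
  PairOddPartLaw → AizenmanOddDomination → StrandsJoinBound

/-- STUB 4 statement — the route's glue `LatticeBoundFromStrands` (item 14648) BY NAME:
K1 at `a = l•tetra ⊂ Λ_N` + the finite-graph bound on the induced box graph, transported to the free box
measure of `ℤ³` and passed to the limit `N → ∞` (`criticalCorr_wellDefined_holds`, continuity at `β_c(ℤ³)`). -/
def LatticeTransport : Prop :=
  LatticeBoundFromStrands

end Statements

/-! ## §2 The registered stubs (`sorry` lives only in these four theorems) -/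

section Stubs

open scoped Classical

/-! ### S1 — the pair law -/

/-- **STUB 1 · `stub_pairOddPartLaw`** — the two-current odd-part law for an arbitrary functional
(= `PairOddPartLaw` verbatim). Size S–M. Route to fill: Tonelli (`ENNReal.tsum_prod'`,
`ENNReal.tsum_mul_left`, `epairWeight_eq_mul`) + the landed one-copy law twice. -/
theorem stub_pairOddPartLaw :
    ∀ (V : Type) [Fintype V] [DecidableEq V] (G : SimpleGraph V) [DecidableRel G.Adj] (β : ℝ), 0 ≤ β →
    ∀ (A B : Finset V) (g : Finset (Sym2 V) → Finset (Sym2 V) → ℝ≥0∞),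
      ∑' p : Current G × Current G,
          epairWeight (fun _ : G.edgeFinset => β) A B p *
            g ((Finset.univ.filter fun e : G.edgeFinset => Odd (p.1 e)).map (Function.Embedding.subtype _))
              ((Finset.univ.filter fun e : G.edgeFinset => Odd (p.2 e)).map (Function.Embedding.subtype _)) =
        ∑ F₁ ∈ G.edgeFinset.powerset, if (∀ v, Odd (F₁.filter (v ∈ ·)).card ↔ v ∈ A) then
          ENNReal.ofReal (Real.sinh β ^ F₁.card * Real.cosh β ^ (G.edgeFinset.card - F₁.card)) *
            ∑ F₂ ∈ G.edgeFinset.powerset, (if (∀ v, Odd (F₂.filter (v ∈ ·)).card ↔ v ∈ B) then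
              ENNReal.ofReal (Real.sinh β ^ F₂.card * Real.cosh β ^ (G.edgeFinset.card - F₂.card)) *
                g F₁ F₂ else 0)
          else 0 := by
  sorry

/-! ### S2 — Aizenman's identity + odd-part domination -/

/-- **STUB 2 · `stub_aizenmanOddDomination`** — `Z[D]Z[∅] + 2·OddJoin ≤ ΣZZ` in `ℝ≥0∞`
(= `AizenmanOddDomination` verbatim). Size S. Route to fill: rewrite the right side by
`Current.ursellFour_currentSum_identity` and compare the two `tsum`s termwise. -/
theorem stub_aizenmanOddDomination :
    ∀ (V : Type) [Fintype V] [DecidableEq V] (G : SimpleGraph V) [DecidableRel G.Adj] (β : ℝ), 0 ≤ β →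
    ∀ a : Fin 4 → V,
      ecurrentSum (fun _ : G.edgeFinset => β) ({a 0} ∆ ({a 1} ∆ ({a 2} ∆ {a 3}))) *
            ecurrentSum (fun _ : G.edgeFinset => β) ∅ +
          2 * (∑' p : Current G × Current G,
            epairWeight (fun _ : G.edgeFinset => β) ({a 0} ∆ {a 1}) ({a 2} ∆ {a 3}) p *
              (if (SimpleGraph.fromEdgeSet
                  ((↑((Finset.univ.filter fun e : G.edgeFinset => Odd (p.1 e)).map
                      (Function.Embedding.subtype _)) : Set (Sym2 V)) ∪
                    ↑((Finset.univ.filter fun e : G.edgeFinset => Odd (p.2 e)).map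
                      (Function.Embedding.subtype _)))).Reachable (a 0) (a 2)
                then 1 else 0)) ≤
        ecurrentSum (fun _ : G.edgeFinset => β) ({a 0} ∆ {a 1}) *
            ecurrentSum (fun _ : G.edgeFinset => β) ({a 2} ∆ {a 3}) +
          ecurrentSum (fun _ : G.edgeFinset => β) ({a 0} ∆ {a 2}) *
            ecurrentSum (fun _ : G.edgeFinset => β) ({a 1} ∆ {a 3}) +
          ecurrentSum (fun _ : G.edgeFinset => β) ({a 0} ∆ {a 3}) *
            ecurrentSum (fun _ : G.edgeFinset => β) ({a 1} ∆ {a 2}) := by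
  sorry

/-! ### S3 — evaluation, cast to `ℝ`, correlator dictionary -/

/-- **STUB 3 · `stub_strandsJoinBound_of`** — law + domination ⇒ `StrandsJoinBound` (item 14647)
(= `StrandsJoinOfLaw` with both hypotheses expanded). Size M (the largest after S4). Route to fill: law at `g = 1[a₀ ↔ a₂ in F₁ ∪ F₂]`, `sinh^k cosh^{|E|-k} = cosh^{|E|} tanh^k` termwise, `toReal`, `Z[∅] = cosh^{|E|} Z⁰_t` (`ecurrentSum_empty_eq_ofReal`), `⟨σ…σ⟩^free = Z[S]/Z[∅]` (`isingExpect_spinMonomial_four_eq`, `isingTwoPoint_free_eq_currentSum_div_holds`), `field_simp; nlinarith`. -/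
theorem stub_strandsJoinBound_of :
    (∀ (V : Type) [Fintype V] [DecidableEq V] (G : SimpleGraph V) [DecidableRel G.Adj] (β : ℝ), 0 ≤ β →
      ∀ (A B : Finset V) (g : Finset (Sym2 V) → Finset (Sym2 V) → ℝ≥0∞),
        ∑' p : Current G × Current G,
            epairWeight (fun _ : G.edgeFinset => β) A B p *
              g ((Finset.univ.filter fun e : G.edgeFinset => Odd (p.1 e)).map (Function.Embedding.subtype _))
                ((Finset.univ.filter fun e : G.edgeFinset => Odd (p.2 e)).map (Function.Embedding.subtype _)) =
          ∑ F₁ ∈ G.edgeFinset.powerset, if (∀ v, Odd (F₁.filter (v ∈ ·)).card ↔ v ∈ A) then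
            ENNReal.ofReal (Real.sinh β ^ F₁.card * Real.cosh β ^ (G.edgeFinset.card - F₁.card)) *
              ∑ F₂ ∈ G.edgeFinset.powerset, (if (∀ v, Odd (F₂.filter (v ∈ ·)).card ↔ v ∈ B) then
                ENNReal.ofReal (Real.sinh β ^ F₂.card * Real.cosh β ^ (G.edgeFinset.card - F₂.card)) *
                  g F₁ F₂ else 0)
            else 0) →
    (∀ (V : Type) [Fintype V] [DecidableEq V] (G : SimpleGraph V) [DecidableRel G.Adj] (β : ℝ), 0 ≤ β →
      ∀ a : Fin 4 → V,
        ecurrentSum (fun _ : G.edgeFinset => β) ({a 0} ∆ ({a 1} ∆ ({a 2} ∆ {a 3}))) *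
              ecurrentSum (fun _ : G.edgeFinset => β) ∅ +
            2 * (∑' p : Current G × Current G,
              epairWeight (fun _ : G.edgeFinset => β) ({a 0} ∆ {a 1}) ({a 2} ∆ {a 3}) p *
                (if (SimpleGraph.fromEdgeSet
                    ((↑((Finset.univ.filter fun e : G.edgeFinset => Odd (p.1 e)).map
                        (Function.Embedding.subtype _)) : Set (Sym2 V)) ∪
                      ↑((Finset.univ.filter fun e : G.edgeFinset => Odd (p.2 e)).map
                        (Function.Embedding.subtype _)))).Reachable (a 0) (a 2)
                  then 1 else 0)) ≤
          ecurrentSum (fun _ : G.edgeFinset => β) ({a 0} ∆ {a 1}) *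
              ecurrentSum (fun _ : G.edgeFinset => β) ({a 2} ∆ {a 3}) +
            ecurrentSum (fun _ : G.edgeFinset => β) ({a 0} ∆ {a 2}) *
              ecurrentSum (fun _ : G.edgeFinset => β) ({a 1} ∆ {a 3}) +
            ecurrentSum (fun _ : G.edgeFinset => β) ({a 0} ∆ {a 3}) *
              ecurrentSum (fun _ : G.edgeFinset => β) ({a 1} ∆ {a 2})) →
    StrandsJoinBound := by
  sorry

/-! ### S4 — the lattice transport (route glue `LatticeBoundFromStrands`, item 14648) -/

/-- **STUB 4 · `stub_latticeBoundFromStrands`** — the route glue `LatticeBoundFromStrands`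
(item 14648) BY NAME. Size M (hardest: longest). Route to fill: K1 at `N ≥ max N₀ l` + the inlined finite bound on the induced
box graph (`defect_of_join`), transport (`connectedFour_boxComap`), seven free box limits
(`criticalCorr_wellDefined_holds (d := 3)`, bc = free) through the closed cone. -/
theorem stub_latticeBoundFromStrands : LatticeBoundFromStrands := by
  sorry

end Stubs


/-! ### Consistency: each named statement IS its registered stub (definitionally) -/

theorem pairOddPartLaw_holds : PairOddPartLaw := stub_pairOddPartLaw
theorem aizenmanOddDomination_holds : AizenmanOddDomination := stub_aizenmanOddDomination
theorem strandsJoinOfLaw_holds : StrandsJoinOfLaw := stub_strandsJoinBound_of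
theorem latticeTransport_holds : LatticeTransport := stub_latticeBoundFromStrands

/-! ### Name-keyed aliases of the four statements (the hypotheses of the composition) -/
namespace Registered

/-- Alias of `PairOddPartLaw` keyed by the registered stub name. -/
abbrev stub_pairOddPartLaw : Prop := PairOddPartLaw
/-- Alias of `AizenmanOddDomination` keyed by the registered stub name. -/
abbrev stub_aizenmanOddDomination : Prop := AizenmanOddDomination
/-- Alias of `StrandsJoinOfLaw` keyed by the registered stub name. -/
abbrev stub_strandsJoinBound_of : Prop := StrandsJoinOfLaw
/-- Alias of `LatticeTransport` (= `LatticeBoundFromStrands`) keyed by the registered stub name. -/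
abbrev stub_latticeBoundFromStrands : Prop := LatticeTransport

end Registered

/-! ## §3 The composition — PROVED (no stub inside): stubs ⇒ crux BY NAME -/

/-- **`JoinForcesU4_of`** — the glue of the line: the pair law (S1) and the Aizenman/odd-part
domination (S2) give `StrandsJoinBound` (S3); the lattice transport (S4) turns the crux hypothesis
`IndependentStrandsJoin` into the tetrahedral lattice bound `U₄^crit(l•tetra) ≤ −c·G·G` for all `l ≥ 1`;
the LANDED item 4471 (`farMergingGivesU4_proof`, dilations `L = max L₀ 1`, shape `tetra`) concludes
`HasNontrivialU4 S` for every non-degenerate pointwise limit — i.e. the crux decl `JoinForcesU4`. -/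
theorem JoinForcesU4_of (h₁ : Registered.stub_pairOddPartLaw) (h₂ : Registered.stub_aizenmanOddDomination)
    (h₃ : Registered.stub_strandsJoinBound_of) (h₄ : Registered.stub_latticeBoundFromStrands) :
    Summit.CriticalPhenomena.Ising3DConformalLimit.Theses.FKParityRobustness.JoinForcesU4 := by
  intro hK1 ρ S hρ hlim hnd
  obtain ⟨c, hc, hlat⟩ := h₄ hK1 (h₃ h₁ h₂)
  exact Summit.CriticalPhenomena.Ising3DConformalLimit.FKParityRobustnessFarMergingGivesU4.farMergingGivesU4_proof
    ⟨c, hc, tetra, tetra_inj, fun L₀ => ⟨max L₀ 1, le_max_left _ _, hlat (max L₀ 1) (le_max_right _ _)⟩⟩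
    ρ S hρ hlim hnd

/-- Wiring check: the registered stubs feed `JoinForcesU4_of` as stated (the verbatim restatements are
definitionally the named statements); kept an `example` so that `JoinForcesU4_of` stays the ONLY
declaration of the file concluding the crux. -/
example : Summit.CriticalPhenomena.Ising3DConformalLimit.Theses.FKParityRobustness.JoinForcesU4 :=
  JoinForcesU4_of stub_pairOddPartLaw stub_aizenmanOddDomination stub_strandsJoinBound_of
    stub_latticeBoundFromStrands

/-- S1–S3 give the support item 14647 and S4 is the support item 14648 (wiring, as `example`s). -/
example : StrandsJoinBound := stub_strandsJoinBound_of stub_pairOddPartLaw stub_aizenmanOddDomination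
example : LatticeBoundFromStrands := stub_latticeBoundFromStrands

/-! ## §4 Disproof / Negative knowledge honoured — see the module docstring; the landed lemmas
`Summit.CriticalPhenomena.Ising3DConformalLimit.Theorems.JoinForcesU4.Negative.not_crux_imp_not_support`
(`¬ JoinForcesU4 → ¬ StrandsJoinBound ∨ ¬ LatticeBoundFromStrands`: a refutation breaks the target of S3 or S4),
`withoutNondegeneracy_iff_not_strandsJoin`, `withoutLimit_iff_not_strandsJoin`, `iff_withoutPositivity` of
`Theorems/JoinForcesU4/Negative/LoadBearing.lean` are cited, not imported (module not yet built on the farm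
at planning time). -/

end Summit.CriticalPhenomena.Ising3DConformalLimit.Cruxes.JoinForcesU4.OddPartFubini

end
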